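import Literature.NumberTheory.EllipticCurves.ModularSymbolRep
import Literature.NumberTheory.EllipticCurves.ModularFunctionField
import Literature.NumberTheory.EllipticCurves.KleinJIntegralQExpansion
import Literature.ModelTheory.ExponentialFields.SemialgebraicC1TriangulationProofs
import Mathlib.RingTheory.Polynomial.Content
import HarnessLib

/-!
# Modular symbols as Kontsevich–Zagier representations — proof file

Discharge of the named fact
`Literature.NumberTheory.EllipticCurves.ModularForms.isSemialgebraicFunOn_arcIntegrand_slash` of
`ModularSymbolRep.lean`: for a weight-`2` cusp form `f` on `Γ₀(N)` with rational Fourier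
coefficients and `g ∈ SL₂(ℤ)`, the real and imaginary parts of the canonical integrand
`u ↦ arcIntegrand (f ∣ g) u = (ω_f/dj)(g · i t₊(u))` are `ℚ`-semialgebraic functions on
`(1728, ∞)`.

## Proof architecture (the three printed inputs named in the fact's docstring, and their stand-ins)

* (i) ALGEBRAICITY OVER `ℚ(j)` (Shimura 1971, Thm. 6.6, Prop. 6.9: `(f ∣ g)Δ/(E₄²E₆) ∈ 𝔉_N` is
  algebraic over `ℚ(j)`). The tree has no `𝔉_N`; instead we run the **Sturm count** of the tree's
  `ModularFunctionField.exists_polynomial_relation_kleinJL` OVER `ℚ`: the `(μ+1)(n+1)` forms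
  `E₄^{3t} Δ^{n-t} (fΔ)^i (E₄²E₆)^{μ-i} ∈ M_{12n+14μ}(Γ₀(N))` have RATIONAL `q`-expansions, so for
  `n ≫ 0` a non-trivial RATIONAL combination has its first `⌊(12n+14μ)μ/12⌋ + 1` coefficients zero
  and vanishes by Sturm's bound (`modularForm_eq_zero_of_qExpansion_coeff_eq_zero`); dividing by
  `Δⁿ(E₄²E₆)^μ` gives `P(j, fΔ/(E₄²E₆)) = 0` with `0 ≠ P ∈ ℚ[U][V]`; `j ∘ g = j` transports it to
  `f ∣ g`, and the primitive part of `P` vanishes on no vertical line (`minpoly` argument), so the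
  graph of `w = arcIntegrand (f ∣ g)` lies in a `ℚ`-algebraic subset of `ℝ × ℂ` with finite fibres.
* (ii) CONTINUITY of `w` on `(1728, ∞)`: `continuousOn_arcIntegrand` (statement file).
* (iii) SEMIALGEBRAIC BRANCHES (Basu–Pollack–Roy 2006, Thm. 5.6 / Cor. 5.7): the tree's proved
  cylindrical decomposition over the coefficient ring
  (`IsSemialgebraic.exists_cylindricalDecomposition_holds`), the description of cells with finite
  vertical fibres as graphs (`IsCylindricalDecomposition.exists_eq_graphOver_of_finite_fibres`) and
  connectedness of cells (`isPreconnected_of_mem`) give the **selection lemma**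
  `isSemialgebraicFunOn_of_continuousOn_of_finite_fibres`: a continuous function whose graph lies in
  a `k`-semialgebraic set with finite vertical fibres is `k`-semialgebraic. The real and imaginary
  parts are reached through the Tarski–Seidenberg projections (`tarski_seidenberg_real_holds`) of
  `{(u, a, b) | P(u, a + ib) = 0} ⊆ ℝ³`.

Everything is proved; no definitions and no named facts are introduced. The value
`Q(u, w) = ∑ᵢ cᵢ(u) wⁱ` of `Q ∈ ℚ[U][V]` at complex arguments is written
`eval₂ (Polynomial.aeval u : ℚ[X] →+* ℂ) w Q` throughout ("`evalC`" in lemma names).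

## References

* G. Shimura, *Introduction to the arithmetic theory of automorphic functions*, 1971, §2.1
  Prop. 2.11 (degree bound over `ℂ(j)`), §6.1–6.2 Thm. 6.6, Prop. 6.9. [Shimura1971]
* J. Sturm, *On the congruence of modular forms*, LNM 1240 (1987), Thm. 1 (via
  `ModularCurveSturmProofs`).
* S. Basu, R. Pollack, M.-F. Roy, *Algorithms in Real Algebraic Geometry*, 2nd ed., 2006,
  Thm. 2.76–2.77, Def. 5.1, Prop. 5.3, Thm. 5.6, Cor. 5.7. [BasuPollackRoy2006]
* M. Kontsevich, D. Zagier, *Periods*, 2001, §3.4. [KontsevichZagier2001]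
-/

noncomputable section

open scoped MatrixGroups ModularForm Manifold Polynomial Polynomial.Bivariate
open Set Filter Function Complex CongruenceSubgroup
open Polynomial (eval₂)
open _root_.Topology
open UpperHalfPlane hiding I
open Literature.ModelTheory.ExponentialFields
open Literature.NumberTheory.Transcendental (IsSemialgebraicFunOn isSemialgebraicFunOn_iff)

namespace Literature.NumberTheory.EllipticCurves.ModularForms

/-! ### Selection: a continuous function with graph in a finite-fibred semialgebraic set -/

section Selection

variable {k : Type*} [CommRing k] [Algebra k ℝ] {n : ℕ}

/-- **Semialgebraic selection along a continuous branch.** Let `σ ⊆ ℝⁿ⁺¹` be `k`-semialgebraic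
with finite vertical fibres `{t | (x, t) ∈ σ}`, `D ⊆ ℝⁿ` `k`-semialgebraic, and `φ` continuous on
`D` with `(x, φ x) ∈ σ` for `x ∈ D`. Then `φ` is a `k`-semialgebraic function on `D`. Proof: in a
cylindrical decomposition adapted to `σ ∩ (D × ℝ)` (Basu–Pollack–Roy Cor. 5.7 over the coefficient
ring, `IsSemialgebraic.exists_cylindricalDecomposition_holds`) every cell of that set is the graph
of a continuous semialgebraic section over a connected base cell (no bands: the fibres are finite,
`IsCylindricalDecomposition.exists_eq_graphOver_of_finite_fibres`); over a base cell the continuous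
`φ` cannot jump between the finitely many pairwise disjoint sheets, so its graph is a union of
cells. [cite: BasuPollackRoy2006, Thm. 5.6, Cor. 5.7 and Prop. 5.3] -/
theorem isSemialgebraicFunOn_of_continuousOn_of_finite_fibres {σ : Set (Fin (n + 1) → ℝ)}
    (hσ : IsSemialgebraic k σ)
    (hfin : ∀ x : Fin n → ℝ, {t : ℝ | (Fin.snoc x t : Fin (n + 1) → ℝ) ∈ σ}.Finite)
    {D : Set (Fin n → ℝ)} (hD : IsSemialgebraic k D) {φ : (Fin n → ℝ) → ℝ} (hφ : ContinuousOn φ D)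
    (hmem : ∀ x ∈ D, (Fin.snoc x (φ x) : Fin (n + 1) → ℝ) ∈ σ) : IsSemialgebraicFunOn k D φ := by
  classical
  -- the part of `σ` over `D`
  set σ' : Set (Fin (n + 1) → ℝ) := σ ∩ {z | Fin.init z ∈ D} with hσ'def
  have hσ' : IsSemialgebraic k σ' := hσ.inter hD.setOf_init_mem
  -- an adapted cylindrical decomposition; the cells of `σ'` are graphs over base cells
  obtain ⟨𝒯, h𝒯, had⟩ := IsSemialgebraic.exists_cylindricalDecomposition_holds (k := k)
    ({σ'} : Finset (Set (Fin (n + 1) → ℝ))) (by simpa using hσ')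
  obtain ⟨𝒞, h𝒞𝒯, hU⟩ := had σ' (Finset.mem_singleton_self σ')
  have hfin' : ∀ x : Fin n → ℝ,
      {y : ℝ | (Fin.snoc x y : Fin (n + 1) → ℝ) ∈ ⋃₀ (𝒞 : Set (Set (Fin (n + 1) → ℝ)))}.Finite := by
    intro x
    rw [hU]
    exact (hfin x).subset fun y hy => hy.1
  obtain ⟨𝒮, h𝒮, -, hgraph⟩ := h𝒯.exists_eq_graphOver_of_finite_fibres h𝒞𝒯 hfin'
  choose! S hS𝒮 F hFc hFsa hCeq using hgraph
  have h𝒯part := h𝒯.isPartition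
  have h𝒮part := h𝒮.isPartition
  -- every point of the graph of `φ` over `D` lies in a cell of `𝒞`
  have hcover : ∀ x ∈ D, ∃ C ∈ 𝒞, x ∈ S C ∧ φ x = F C x := by
    intro x hx
    have hz : (Fin.snoc x (φ x) : Fin (n + 1) → ℝ) ∈ σ' := ⟨hmem x hx, by simpa using hx⟩
    rw [← hU] at hz
    obtain ⟨C, hC, hzC⟩ := mem_sUnion.mp hz
    rw [hCeq C hC, snoc_mem_graphOver_iff] at hzC
    exact ⟨C, hC, hzC.1, hzC.2⟩
  -- base cells of members of `𝒞` lie in `D`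
  have hSD : ∀ C ∈ 𝒞, S C ⊆ D := by
    intro C hC x hx
    have hz : (Fin.snoc x (F C x) : Fin (n + 1) → ℝ) ∈ σ' := by
      rw [← hU]
      exact mem_sUnion.mpr ⟨C, hC, (hCeq C hC).symm.subset (snoc_mem_graphOver_iff.mpr ⟨hx, rfl⟩)⟩
    simpa using hz.2
  -- two sheets over the same base cell through a common point coincide
  have hsheet : ∀ C₁ ∈ 𝒞, ∀ C₂ ∈ 𝒞, S C₂ = S C₁ → ∀ x ∈ S C₁, F C₁ x = F C₂ x → C₁ = C₂ := by
    intro C₁ hC₁ C₂ hC₂ hS x hx hF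
    have h1 : (Fin.snoc x (F C₁ x) : Fin (n + 1) → ℝ) ∈ C₁ :=
      (hCeq C₁ hC₁).symm.subset (snoc_mem_graphOver_iff.mpr ⟨hx, rfl⟩)
    have h2 : (Fin.snoc x (F C₁ x) : Fin (n + 1) → ℝ) ∈ C₂ :=
      (hCeq C₂ hC₂).symm.subset (snoc_mem_graphOver_iff.mpr ⟨hS.symm ▸ hx, hF⟩)
    exact h𝒯part.eq_of_mem_of_mem (h𝒞𝒯 hC₁) (h𝒞𝒯 hC₂) h1 h2
  -- over the base cell of a member `C` of `𝒞`, `φ` follows the sheet `C`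
  have hfollow : ∀ C ∈ 𝒞, ∀ x₀ ∈ S C, φ x₀ = F C x₀ → ∀ x ∈ S C, φ x = F C x := by
    intro C hC x₀ hx₀ hφx₀
    -- the competing sheets over `S C`
    set 𝒞S := 𝒞.filter fun C' => S C' = S C with h𝒞S
    have hmem𝒞S : ∀ {C'}, C' ∈ 𝒞S ↔ C' ∈ 𝒞 ∧ S C' = S C := fun {C'} => by
      rw [h𝒞S, Finset.mem_filter]
    -- every point of `S C` lies on one of them
    have hcov : ∀ x ∈ S C, ∃ C' ∈ 𝒞S, φ x = F C' x := by
      intro x hx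
      obtain ⟨C', hC', hxS', hφ'⟩ := hcover x (hSD C hC hx)
      refine ⟨C', hmem𝒞S.mpr ⟨hC', ?_⟩, hφ'⟩
      exact h𝒮part.eq_of_mem_of_mem (hS𝒮 C' hC') (hS𝒮 C hC) hxS' hx
    -- relatively closed pieces `A C' = {x ∈ S C | φ x = F C' x}`
    have hclosed : ∀ C' ∈ 𝒞S, ∃ u : Set (Fin n → ℝ), IsClosed u ∧
        {x | φ x = F C' x} ∩ S C = u ∩ S C := by
      intro C' hC'
      obtain ⟨hC'𝒞, hSC'⟩ := hmem𝒞S.mp hC'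
      have hcont : ContinuousOn (fun x => φ x - F C' x) (S C) :=
        (hφ.mono (hSD C hC)).sub (hSC' ▸ hFc C' hC'𝒞)
      obtain ⟨u, hu, hu'⟩ := (continuousOn_iff_isClosed.mp hcont) {0} isClosed_singleton
      refine ⟨u, hu, ?_⟩
      rw [← hu']
      ext x
      simp [sub_eq_zero]
    choose! u hu hueq using hclosed
    have hC𝒞S : C ∈ 𝒞S := hmem𝒞S.mpr ⟨hC, rfl⟩
    -- `S C ⊆ u C ∪ ⋃_{C' ≠ C} u C'`, the two closed sets meeting `S C` disjointly
    set v : Set (Fin n → ℝ) := ⋃ C' ∈ 𝒞S.erase C, u C' with hv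
    have hvclosed : IsClosed v := by
      rw [hv]
      exact isClosed_biUnion_finset fun C' hC' => hu C' (Finset.mem_of_mem_erase hC')
    have hpre : IsPreconnected (S C) := h𝒮.isPreconnected_of_mem _ (hS𝒮 C hC)
    have hsub : S C ⊆ u C ∪ v := by
      intro x hx
      obtain ⟨C', hC', hφ'⟩ := hcov x hx
      by_cases hCC' : C' = C
      · subst hCC'
        have : x ∈ {x | φ x = F C' x} ∩ S C' := ⟨hφ', hx⟩
        rw [hueq C' hC'] at this
        exact Or.inl this.1
      · have : x ∈ {x | φ x = F C' x} ∩ S C := ⟨hφ', hx⟩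
        rw [hueq C' hC'] at this
        refine Or.inr ?_
        rw [hv]
        exact mem_biUnion (Finset.mem_erase.mpr ⟨hCC', hC'⟩) this.1
    have hdisj : S C ∩ (u C ∩ v) = ∅ := by
      ext x
      simp only [mem_inter_iff, mem_empty_iff_false, iff_false, not_and]
      intro hx hxu hxv
      rw [hv] at hxv
      obtain ⟨C', hC', hxC'⟩ := mem_iUnion₂.mp hxv
      obtain ⟨hCC', hC'S⟩ := Finset.mem_erase.mp hC'
      have h1 : x ∈ u C ∩ S C := ⟨hxu, hx⟩
      have h2 : x ∈ u C' ∩ S C := ⟨hxC', hx⟩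
      rw [← hueq C hC𝒞S] at h1
      rw [← hueq C' hC'S] at h2
      have hF : F C x = F C' x := h1.1.symm.trans h2.1
      exact hCC' (hsheet C hC C' (hmem𝒞S.mp hC'S).1 (hmem𝒞S.mp hC'S).2 x hx hF).symm
    rcases isPreconnected_iff_subset_of_disjoint_closed.mp hpre (u C) v (hu C hC𝒞S) hvclosed hsub
      hdisj with h | h
    · intro x hx
      have : x ∈ u C ∩ S C := ⟨h hx, hx⟩
      rw [← hueq C hC𝒞S] at this
      exact this.1
    · exfalso
      have hx₀v := h hx₀
      rw [hv] at hx₀v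
      obtain ⟨C', hC', hxC'⟩ := mem_iUnion₂.mp hx₀v
      obtain ⟨hCC', hC'S⟩ := Finset.mem_erase.mp hC'
      have h2 : x₀ ∈ u C' ∩ S C := ⟨hxC', hx₀⟩
      rw [← hueq C' hC'S] at h2
      have hF : F C x₀ = F C' x₀ := hφx₀.symm.trans h2.1
      exact hCC' (hsheet C hC C' (hmem𝒞S.mp hC'S).1 (hmem𝒞S.mp hC'S).2 x₀ hx₀ hF).symm
  -- the graph of `φ` over `D` is the union of the cells of `𝒞` it contains
  rw [isSemialgebraicFunOn_iff]
  have hgraph : {z : Fin (n + 1) → ℝ | Fin.init z ∈ D ∧ z (Fin.last n) = φ (Fin.init z)} =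
      ⋃ C ∈ 𝒞.filter (fun C => C ⊆ {z : Fin (n + 1) → ℝ | Fin.init z ∈ D ∧
        z (Fin.last n) = φ (Fin.init z)}), C := by
    apply Subset.antisymm
    · intro z hz
      obtain ⟨hzD, hzφ⟩ := hz
      obtain ⟨C, hC, hxS, hφx⟩ := hcover (Fin.init z) hzD
      have hzC : z ∈ C := by
        rw [hCeq C hC, mem_graphOver_iff]; exact ⟨hxS, hzφ.trans hφx⟩
      refine mem_biUnion (Finset.mem_filter.mpr ⟨hC, fun z' hz' => ?_⟩) hzC
      rw [hCeq C hC, mem_graphOver_iff] at hz'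
      refine ⟨hSD C hC hz'.1, ?_⟩
      rw [hz'.2]
      exact (hfollow C hC (Fin.init z) hxS hφx (Fin.init z') hz'.1).symm
    · intro z hz
      obtain ⟨C, hC, hzC⟩ := mem_iUnion₂.mp hz
      exact (Finset.mem_filter.mp hC).2 hzC
  rw [hgraph]
  exact IsSemialgebraic.biUnion _ _ fun C hC =>
    h𝒯.isSemialgebraic C (h𝒞𝒯 (Finset.mem_filter.mp hC).1)

end Selection

/-! ### Real and imaginary parts of `P(u, a + ib)` as polynomials over `ℚ` -/

section ReIm

open MvPolynomial

/-- The real and imaginary parts of `(x₁ + i x₂)^m` are polynomials over `ℚ` in `x₁, x₂`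
(recursion `(A + iB)(R + iJ) = (AR - BJ) + i(AJ + BR)`). [folklore] -/
theorem exists_reIm_pow (m : ℕ) : ∃ RI : MvPolynomial (Fin 3) ℚ × MvPolynomial (Fin 3) ℚ,
    ∀ x : Fin 3 → ℝ, ((aeval x RI.1 : ℝ) : ℂ) + ((aeval x RI.2 : ℝ) : ℂ) * Complex.I =
      ((x 1 : ℂ) + (x 2 : ℂ) * Complex.I) ^ m := by
  induction m with
  | zero => exact ⟨(1, 0), fun x => by simp⟩
  | succ m ih =>
    obtain ⟨RI, hRI⟩ := ih
    refine ⟨(X 1 * RI.1 - X 2 * RI.2, X 1 * RI.2 + X 2 * RI.1), fun x => ?_⟩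
    simp only [map_sub, map_mul, map_add, aeval_X, pow_succ, ← hRI x]
    push_cast
    ring_nf
    rw [Complex.I_sq]
    ring

/-- `evalC` as evaluation of the specialised one-variable polynomial `Q(u, ·) ∈ ℂ[V]`. [folklore] -/
theorem evalC_eq_eval_map (Q : ℚ[X][Y]) (u w : ℂ) :
    eval₂ (Polynomial.aeval (R := ℚ) u : ℚ[X] →+* ℂ) w Q =
      (Q.map (Polynomial.aeval (R := ℚ) u : ℚ[X] →+* ℂ)).eval w := by
  rw [Polynomial.eval_map]

/-- Evaluating a coefficient `c ∈ ℚ[U]` at `X₀` and then at `x` is evaluating `c` at `x₀`.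
[folklore] -/
theorem aeval_aeval_X_zero (c : ℚ[X]) (x : Fin 3 → ℝ) :
    ((aeval x (Polynomial.aeval (X 0 : MvPolynomial (Fin 3) ℚ) c) : ℝ) : ℂ) =
      Polynomial.aeval ((x 0 : ℝ) : ℂ) c := by
  rw [← Polynomial.aeval_algHom_apply, aeval_X]
  exact (Polynomial.aeval_algebraMap_apply ℂ (x 0) c).symm

/-- **`re` and `im` of `Q(x₀, x₁ + i x₂)` are polynomials over `ℚ` in `(x₀, x₁, x₂)`** for
`Q ∈ ℚ[U][V]`. [folklore] -/
theorem exists_reIm_parts (Q : ℚ[X][Y]) : ∃ RI : MvPolynomial (Fin 3) ℚ × MvPolynomial (Fin 3) ℚ,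
    ∀ x : Fin 3 → ℝ, ((aeval x RI.1 : ℝ) : ℂ) + ((aeval x RI.2 : ℝ) : ℂ) * Complex.I =
      eval₂ (Polynomial.aeval (R := ℚ) (x 0 : ℂ) : ℚ[X] →+* ℂ)
        ((x 1 : ℂ) + (x 2 : ℂ) * Complex.I) Q := by
  choose RI hRI using exists_reIm_pow
  refine ⟨(Q.sum fun i c => Polynomial.aeval (X 0 : MvPolynomial (Fin 3) ℚ) c * (RI i).1,
    Q.sum fun i c => Polynomial.aeval (X 0 : MvPolynomial (Fin 3) ℚ) c * (RI i).2), fun x => ?_⟩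
  simp only [Polynomial.eval₂_eq_sum, Polynomial.sum_def, map_sum, map_mul,
    Complex.ofReal_sum, Complex.ofReal_mul, Finset.sum_mul]
  rw [← Finset.sum_add_distrib]
  refine Finset.sum_congr rfl fun i _ => ?_
  rw [← hRI i x, aeval_aeval_X_zero]
  have : ((Polynomial.aeval (R := ℚ) ((x 0 : ℝ) : ℂ) : ℚ[X] →+* ℂ) (Q.coeff i) : ℂ) =
      Polynomial.aeval ((x 0 : ℝ) : ℂ) (Q.coeff i) := rfl
  rw [this]
  ring

/-- **The zero set `{(u, a, b) | Q(u, a + ib) = 0} ⊆ ℝ³` is `ℚ`-semialgebraic.** [folklore] -/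
theorem isSemialgebraic_setOf_evalC_eq_zero (Q : ℚ[X][Y]) :
    IsSemialgebraic ℚ {x : Fin 3 → ℝ | eval₂ (Polynomial.aeval (R := ℚ) (x 0 : ℂ) : ℚ[X] →+* ℂ)
      ((x 1 : ℂ) + (x 2 : ℂ) * Complex.I) Q = 0} := by
  obtain ⟨RI, hRI⟩ := exists_reIm_parts Q
  have h : {x : Fin 3 → ℝ | eval₂ (Polynomial.aeval (R := ℚ) (x 0 : ℂ) : ℚ[X] →+* ℂ)
      ((x 1 : ℂ) + (x 2 : ℂ) * Complex.I) Q = 0} =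
        {x | aeval x RI.1 = 0} ∩ {x | aeval x RI.2 = 0} := by
    ext x
    rw [mem_setOf_eq, ← hRI x, Complex.ext_iff]
    simp
  rw [h]
  exact (isSemialgebraic_setOf_eval_eq_zero (R := ℝ) RI.1).inter
    (isSemialgebraic_setOf_eval_eq_zero (R := ℝ) RI.2)

/-- The same zero set with the last two coordinates exchanged, `{(u, b, a) | Q(u, a + ib) = 0}`,
is `ℚ`-semialgebraic. [folklore] -/
theorem isSemialgebraic_setOf_evalC_eq_zero_swap (Q : ℚ[X][Y]) :
    IsSemialgebraic ℚ {x : Fin 3 → ℝ | eval₂ (Polynomial.aeval (R := ℚ) (x 0 : ℂ) : ℚ[X] →+* ℂ)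
      ((x 2 : ℂ) + (x 1 : ℂ) * Complex.I) Q = 0} := by
  have h := (isSemialgebraic_setOf_evalC_eq_zero Q).preimage_comp (Equiv.swap (1 : Fin 3) 2)
  convert h using 1
  ext x
  have h0 : (Equiv.swap (1 : Fin 3) 2) 0 = 0 := by decide
  simp [h0]

/-- **Projection to the real part**: `{(u, a) | ∃ b, Q(u, a + ib) = 0} ⊆ ℝ²` is `ℚ`-semialgebraic
(Tarski–Seidenberg, `tarski_seidenberg_real_holds`). [cite: BasuPollackRoy2006, Thm. 2.76] -/
theorem isSemialgebraic_setOf_exists_evalC_re (Q : ℚ[X][Y]) :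
    IsSemialgebraic ℚ {y : Fin 2 → ℝ | ∃ b : ℝ, eval₂ (Polynomial.aeval (R := ℚ) (y 0 : ℂ) : ℚ[X] →+* ℂ)
      ((y 1 : ℂ) + (b : ℂ) * Complex.I) Q = 0} := by
  have h := tarski_seidenberg_real_holds (k := ℚ) (isSemialgebraic_setOf_evalC_eq_zero Q)
  convert h using 1
  ext y
  simp only [mem_setOf_eq, mem_image]
  constructor
  · rintro ⟨b, hb⟩
    refine ⟨Fin.snoc y b, ?_, ?_⟩
    · simpa [Fin.snoc] using hb
    · ext i; simp [Fin.snoc_castSucc]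
  · rintro ⟨x, hx, rfl⟩
    exact ⟨x 2, by simpa using hx⟩

/-- **Projection to the imaginary part**: `{(u, b) | ∃ a, Q(u, a + ib) = 0} ⊆ ℝ²` is
`ℚ`-semialgebraic. [cite: BasuPollackRoy2006, Thm. 2.76] -/
theorem isSemialgebraic_setOf_exists_evalC_im (Q : ℚ[X][Y]) :
    IsSemialgebraic ℚ {y : Fin 2 → ℝ | ∃ a : ℝ, eval₂ (Polynomial.aeval (R := ℚ) (y 0 : ℂ) : ℚ[X] →+* ℂ)
      ((a : ℂ) + (y 1 : ℂ) * Complex.I) Q = 0} := by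
  have h := tarski_seidenberg_real_holds (k := ℚ) (isSemialgebraic_setOf_evalC_eq_zero_swap Q)
  convert h using 1
  ext y
  simp only [mem_setOf_eq, mem_image]
  constructor
  · rintro ⟨a, ha⟩
    refine ⟨Fin.snoc y a, ?_, ?_⟩
    · simpa [Fin.snoc] using ha
    · ext i; simp [Fin.snoc_castSucc]
  · rintro ⟨x, hx, rfl⟩
    exact ⟨x 2, by simpa using hx⟩

/-- **Finite fibres.** If `Q(u, ·) ≠ 0` then only finitely many real parts `a` (resp. imaginary
parts `b`) of zeros `Q(u, a + ib) = 0` occur. [folklore] -/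
theorem finite_re_of_map_ne_zero (Q : ℚ[X][Y]) {u : ℂ}
    (hu : Q.map (Polynomial.aeval (R := ℚ) u : ℚ[X] →+* ℂ) ≠ 0) :
    {a : ℝ | ∃ b : ℝ,
        eval₂ (Polynomial.aeval (R := ℚ) u : ℚ[X] →+* ℂ) ((a : ℂ) + (b : ℂ) * Complex.I) Q = 0}.Finite ∧
      {b : ℝ | ∃ a : ℝ,
        eval₂ (Polynomial.aeval (R := ℚ) u : ℚ[X] →+* ℂ) ((a : ℂ) + (b : ℂ) * Complex.I) Q = 0}.Finite := by
  have hroots := Polynomial.finite_setOf_isRoot hu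
  constructor
  · refine (hroots.image Complex.re).subset ?_
    rintro a ⟨b, hb⟩
    refine ⟨(a : ℂ) + (b : ℂ) * Complex.I, ?_, by simp⟩
    rw [mem_setOf_eq, Polynomial.IsRoot.def, ← evalC_eq_eval_map]
    exact hb
  · refine (hroots.image Complex.im).subset ?_
    rintro b ⟨a, ha⟩
    refine ⟨(a : ℂ) + (b : ℂ) * Complex.I, ?_, by simp⟩
    rw [mem_setOf_eq, Polynomial.IsRoot.def, ← evalC_eq_eval_map]
    exact ha

/-- **A primitive bivariate polynomial vanishes identically on no vertical line**: if
`Q ∈ ℚ[U][V]` is primitive (over `ℚ[U]`) then `Q(u, ·) ≠ 0` for every real `u` — otherwise the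
minimal polynomial of `u` would divide every coefficient. [folklore] -/
theorem map_ne_zero_of_isPrimitive {Q : ℚ[X][Y]} (hQ : Q.IsPrimitive) (u : ℂ) :
    Q.map (Polynomial.aeval (R := ℚ) u : ℚ[X] →+* ℂ) ≠ 0 := by
  intro h
  have hdvd : Polynomial.C (minpoly ℚ u) ∣ Q := by
    rw [Polynomial.C_dvd_iff_dvd_coeff]
    intro i
    apply minpoly.dvd
    have := congrArg (fun P : ℂ[X] => P.coeff i) h
    simpa [Polynomial.coeff_map] using this
  exact minpoly.not_isUnit ℚ u (hQ _ hdvd)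

end ReIm

/-! ### The rational algebraic relation between `j` and `ω_f/dj` (Sturm count over `ℚ`) -/

section Relation

open ModularForm

variable {N : ℕ}

/-- A complex power series all of whose coefficients are rational is the image of a rational
power series. [folklore] -/
theorem mem_range_map_of_forall_coeff_mem {p : PowerSeries ℂ}
    (h : ∀ n, PowerSeries.coeff n p ∈ Set.range ((↑) : ℚ → ℂ)) :
    p ∈ (PowerSeries.map (algebraMap ℚ ℂ)).range := by
  choose c hc using h
  refine ⟨PowerSeries.mk c, ?_⟩
  ext n
  rw [PowerSeries.coeff_map, PowerSeries.coeff_mk, ← hc n]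
  rfl

/-- An integer power series mapped to `ℂ` has rational coefficients. [folklore] -/
theorem map_intCast_mem_range (p : PowerSeries ℤ) :
    PowerSeries.map (Int.castRingHom ℂ) p ∈ (PowerSeries.map (algebraMap ℚ ℂ)).range := by
  have h : (algebraMap ℚ ℂ).comp (Int.castRingHom ℚ) = Int.castRingHom ℂ := RingHom.ext_int _ _
  refine ⟨PowerSeries.map (Int.castRingHom ℚ) p, ?_⟩
  rw [← RingHom.comp_apply, ← PowerSeries.map_comp, h]

/-- `E₄ = 1 + 240 Σ σ₃(n) qⁿ` has rational `q`-expansion (`qExpansion_E₄`). [folklore] -/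
theorem qExpansion_E₄_mem_range :
    qExpansion 1 ⇑ModularForm.E₄ ∈ (PowerSeries.map (algebraMap ℚ ℂ)).range := by
  rw [qExpansion_E₄]
  exact map_intCast_mem_range _

/-- `Δ = q ∏ (1 - qⁿ)²⁴` has rational `q`-expansion (`qExpansion_discriminant`). [folklore] -/
theorem qExpansion_discriminant_mem_range :
    qExpansion 1 ModularForm.discriminant ∈ (PowerSeries.map (algebraMap ℚ ℂ)).range := by
  rw [qExpansion_discriminant]
  exact map_intCast_mem_range _

/-- `E₆ = 1 - 504 Σ σ₅(n) qⁿ` has rational `q`-expansion (Mathlib's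
`EisensteinSeries.E_qExpansion_coeff`). [folklore] -/
theorem qExpansion_E₆_mem_range :
    qExpansion 1 ⇑ModularForm.E₆ ∈ (PowerSeries.map (algebraMap ℚ ℂ)).range := by
  refine mem_range_map_of_forall_coeff_mem fun m => ?_
  rw [show (ModularForm.E₆ : ModularForm 𝒮ℒ 6) = ModularForm.E (by norm_num : 3 ≤ 6) from rfl,
    EisensteinSeries.E_qExpansion_coeff (by norm_num) (by decide) m]
  split_ifs
  · exact ⟨1, by simp⟩
  · exact ⟨-(2 * 6 / bernoulli 6) * (ArithmeticFunction.sigma (6 - 1) m : ℚ), by push_cast; ring⟩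

/-- **The rational algebraic relation between `j` and `ω_f/dj`.** For a weight-`2` cusp form `f`
on `Γ₀(N)` with rational Fourier coefficients there is a non-zero `P ∈ ℚ[U][V]` with
`P(j(τ), djQuot f τ) = 0` wherever `E₄(τ)E₆(τ) ≠ 0` (`djQuot f = -fΔ/(E₄²E₆)`). This is the
algebraicity of `fΔ/(E₄²E₆)` over `ℚ(j)` (Shimura: it lies in the field `𝔉_N`, finite over
`ℚ(j)`, Thm. 6.6 and Prop. 6.9), proved here by the Sturm count of
`exists_polynomial_relation_kleinJL` run over `ℚ`: the `(μ+1)(n+1)` forms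
`E₄^{3t} Δ^{n-t} (fΔ)^i (E₄²E₆)^{μ-i} ∈ M_{12n+14μ}(Γ₀(N))` have rational `q`-expansions, hence for
`n = 14μ²` a non-trivial rational combination kills the first `⌊(12n+14μ)μ/12⌋ + 1` coefficients
and vanishes by Sturm's bound; divide by `Δⁿ(E₄²E₆)^μ`.
[cite: Shimura1971, §6.2 Thm. 6.6 (1)–(2) and Prop. 6.9 (1); §2.1 Prop. 2.11] -/
theorem exists_rat_relation_djQuot [NeZero N] (f : CuspForm (Gamma0 N) 2) (hf : HasRatCoeffs f) :
    ∃ P : ℚ[X][Y], P ≠ 0 ∧ ∀ τ : ℍ, E₄ τ ≠ 0 → E₆ τ ≠ 0 →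
      eval₂ (Polynomial.aeval (R := ℚ) (kleinJ τ) : ℚ[X] →+* ℂ) (djQuot ⇑f τ) P = 0 := by
  classical
  set μ := gamma0Index N with hμ
  have hμ1 : 1 ≤ μ := one_le_gamma0Index
  set n : ℕ := μ ^ 2 * 14 with hn
  have h1 := one_mem_strictPeriods_coe_gamma0 N
  -- the level-`N` forms `A = E₄³`, `D = Δ`, `F = fΔ`, `G = E₄²E₆`
  set A : ModularForm (Gamma0 N) 12 := ofLevelOne (Gamma0 N) E₄cube with hA
  set D : ModularForm (Gamma0 N) 12 := ofLevelOne (Gamma0 N) delta with hD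
  set F : ModularForm (Gamma0 N) 14 :=
    ((ModularFormClass.modularForm f : ModularForm (Gamma0 N) 2).mul D).mcast (by norm_num) with hF
  set G₁ : ModularForm 𝒮ℒ 14 := ((ModularForm.E₄.pow 2).mul ModularForm.E₆).mcast (by norm_num)
    with hG₁
  set G : ModularForm (Gamma0 N) 14 := ofLevelOne (Gamma0 N) G₁ with hG
  -- the forms `B (i, t) = A^t D^{n-t} F^i G^{μ-i}` of weight `12 n + 14 μ`
  let Bform : Fin (μ + 1) × Fin (n + 1) → ModularForm (Gamma0 N) ((n : ℤ) * 12 + (μ : ℤ) * 14) :=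
    fun p ↦ (((A.pow p.2).mul (D.pow (n - p.2))).mcast
        (natCast_mul_add_natCast_sub_mul (Nat.lt_succ_iff.mp p.2.isLt) 12)).mul
      (((F.pow p.1).mul (G.pow (μ - p.1))).mcast
        (natCast_mul_add_natCast_sub_mul (Nat.lt_succ_iff.mp p.1.isLt) 14))
  -- rational `q`-expansions
  have hqA : qExpansion 1 ⇑A ∈ (PowerSeries.map (algebraMap ℚ ℂ)).range := by
    have : qExpansion 1 ⇑A = qExpansion 1 ⇑ModularForm.E₄ ^ 3 := by
      rw [hA, coe_ofLevelOne, E₄cube, ModularForm.qExpansion_mcast,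
        ModularForm.qExpansion_pow one_pos one_mem_strictPeriods_SL]
    rw [this]
    exact pow_mem qExpansion_E₄_mem_range 3
  have hqD : qExpansion 1 ⇑D ∈ (PowerSeries.map (algebraMap ℚ ℂ)).range := by
    have : qExpansion 1 ⇑D = qExpansion 1 ModularForm.discriminant := by
      rw [hD, coe_ofLevelOne, ← CuspForm.coe_discriminant]; rfl
    rw [this]
    exact qExpansion_discriminant_mem_range
  have hqF : qExpansion 1 ⇑F ∈ (PowerSeries.map (algebraMap ℚ ℂ)).range := by
    rw [hF, ModularForm.qExpansion_mcast, ModularForm.qExpansion_mul one_pos h1]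
    exact mul_mem (mem_range_map_of_forall_coeff_mem hf) hqD
  have hqG : qExpansion 1 ⇑G ∈ (PowerSeries.map (algebraMap ℚ ℂ)).range := by
    have : qExpansion 1 ⇑G = qExpansion 1 ⇑ModularForm.E₄ ^ 2 * qExpansion 1 ⇑ModularForm.E₆ := by
      rw [hG, coe_ofLevelOne, hG₁, ModularForm.qExpansion_mcast,
        ModularForm.qExpansion_mul one_pos one_mem_strictPeriods_SL,
        ModularForm.qExpansion_pow one_pos one_mem_strictPeriods_SL]
    rw [this]
    exact mul_mem (pow_mem qExpansion_E₄_mem_range 2) qExpansion_E₆_mem_range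
  have hqB : ∀ p, ∃ ρ : PowerSeries ℚ,
      PowerSeries.map (algebraMap ℚ ℂ) ρ = qExpansion 1 ⇑(Bform p) := by
    intro p
    apply RingHom.mem_range.mp
    simp only [Bform, ModularForm.qExpansion_mul one_pos h1, ModularForm.qExpansion_mcast,
      ModularForm.qExpansion_pow one_pos h1]
    exact mul_mem (mul_mem (pow_mem hqA _) (pow_mem hqD _))
      (mul_mem (pow_mem hqF _) (pow_mem hqG _))
  choose ρ hρ using hqB
  -- the Sturm bound `T` and the count `T < (μ+1)(n+1)`
  set T : ℕ := (((n : ℤ) * 12 + (μ : ℤ) * 14) * μ).toNat / 12 + 1 with hT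
  have hlt : T < Fintype.card (Fin (μ + 1) × Fin (n + 1)) := by
    rw [Fintype.card_prod, Fintype.card_fin, Fintype.card_fin, hT]
    have h0 : (((n : ℤ) * 12 + (μ : ℤ) * 14) * μ).toNat = 12 * (n * μ) + 14 * μ ^ 2 := by
      have h : ((n : ℤ) * 12 + (μ : ℤ) * 14) * μ = ((12 * (n * μ) + 14 * μ ^ 2 : ℕ) : ℤ) := by
        push_cast; ring
      rw [h, Int.toNat_natCast]
    rw [h0, Nat.mul_add_div (by norm_num : 0 < 12)]
    have h3 : 14 * μ ^ 2 / 12 ≤ n := by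
      rw [hn]
      calc 14 * μ ^ 2 / 12 ≤ 14 * μ ^ 2 := Nat.div_le_self _ _
        _ = μ ^ 2 * 14 := by ring
    nlinarith
  -- a non-trivial rational relation killing the first `T` coefficients
  let Ψ : (Fin (μ + 1) × Fin (n + 1) → ℚ) →ₗ[ℚ] (Fin T → ℚ) :=
    Fintype.linearCombination ℚ fun p m => PowerSeries.coeff (m : ℕ) (ρ p)
  have hlt' : Module.finrank ℚ (Fin T → ℚ) < Module.finrank ℚ (Fin (μ + 1) × Fin (n + 1) → ℚ) := by
    rw [Module.finrank_fin_fun, Module.finrank_pi]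
    exact hlt
  obtain ⟨r, hrker, hr0⟩ : ∃ r ∈ LinearMap.ker Ψ, r ≠ 0 :=
    Submodule.exists_mem_ne_zero_of_ne_bot (LinearMap.ker_ne_bot_of_finrank_lt hlt')
  have hΨ : ∀ m : Fin T, ∑ p, r p * PowerSeries.coeff (m : ℕ) (ρ p) = 0 := by
    intro m
    have := congr_fun (LinearMap.mem_ker.mp hrker) m
    simpa [Ψ, Fintype.linearCombination_apply, Finset.sum_apply, smul_eq_mul] using this
  -- the corresponding complex combination of the `B p` vanishes by Sturm's bound
  set Φ : ModularForm (Gamma0 N) ((n : ℤ) * 12 + (μ : ℤ) * 14) := ∑ p, ((r p : ℚ) : ℂ) • Bform p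
    with hΦ
  have han : ∀ g : ModularForm (Gamma0 N) ((n : ℤ) * 12 + (μ : ℤ) * 14),
      AnalyticAt ℂ (cuspFunction 1 g) 0 := fun g ↦
    ModularFormClass.analyticAt_cuspFunction_zero g one_pos h1
  let L : ModularForm (Gamma0 N) ((n : ℤ) * 12 + (μ : ℤ) * 14) →ₗ[ℂ] (ℕ → ℂ) :=
    { toFun := fun g m ↦ PowerSeries.coeff m (qExpansion 1 ⇑g)
      map_add' := fun g g' ↦ by
        funext m
        simp only [Pi.add_apply]
        rw [ModularForm.coe_add, qExpansion_add (han g) (han g'), map_add]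
      map_smul' := fun c g ↦ by
        funext m
        simp only [Pi.smul_apply, RingHom.id_apply, smul_eq_mul]
        rw [ModularForm.IsGLPos.coe_smul, qExpansion_smul (han g), map_smul, smul_eq_mul] }
  have hLΦ : ∀ m, PowerSeries.coeff m (qExpansion 1 ⇑Φ) =
      ∑ p, ((r p : ℚ) : ℂ) * PowerSeries.coeff m (qExpansion 1 ⇑(Bform p)) := by
    intro m
    have := congr_fun (map_sum L (fun p => ((r p : ℚ) : ℂ) • Bform p) Finset.univ) m
    simp only [map_smul, Finset.sum_apply, Pi.smul_apply, smul_eq_mul] at this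
    rw [hΦ]
    exact this
  have hcoeff : ∀ m < T, PowerSeries.coeff m (qExpansion 1 ⇑Φ) = 0 := by
    intro m hm
    rw [hLΦ]
    have hc : ∀ p, PowerSeries.coeff m (qExpansion 1 ⇑(Bform p)) =
        ((PowerSeries.coeff m (ρ p) : ℚ) : ℂ) := by
      intro p
      rw [← hρ p, PowerSeries.coeff_map, eq_ratCast]
    simp only [hc, ← Rat.cast_mul, ← Rat.cast_sum]
    rw [hΨ ⟨m, hm⟩, Rat.cast_zero]
  have hΦ0 : Φ = 0 := by
    refine modularForm_eq_zero_of_qExpansion_coeff_eq_zero h1 Φ hcoeff ?_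
    rw [card_quotient_subgroupOf_eq_index, index_gamma0_eq_gamma0Index_holds N]
    exact Nat.lt_succ_self _
  -- pointwise form of the relation
  have hpt : ∀ τ : ℍ, ∑ p : Fin (μ + 1) × Fin (n + 1), ((r p : ℚ) : ℂ) *
      ((E₄ τ ^ 3) ^ (p.2 : ℕ) * ModularForm.discriminant τ ^ (n - p.2) *
        ((f τ * ModularForm.discriminant τ) ^ (p.1 : ℕ) * (E₄ τ ^ 2 * E₆ τ) ^ (μ - p.1))) = 0 := by
    intro τ
    have h := congrArg (fun g : ModularForm (Gamma0 N) ((n : ℤ) * 12 + (μ : ℤ) * 14) ↦ g τ) hΦ0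
    simp only [hΦ] at h
    have hcoe : ∀ (s : Finset (Fin (μ + 1) × Fin (n + 1))),
        (⇑(∑ p ∈ s, ((r p : ℚ) : ℂ) • Bform p) : ℍ → ℂ) =
          ∑ p ∈ s, ((r p : ℚ) : ℂ) • ⇑(Bform p) := by
      intro s
      induction s using Finset.induction_on with
      | empty => simp
      | insert a s ha ih =>
        rw [Finset.sum_insert ha, Finset.sum_insert ha, ModularForm.coe_add, ih,
          ModularForm.IsGLPos.coe_smul]
    rw [hcoe, Finset.sum_apply, ModularForm.zero_apply] at h
    rw [← h]
    refine Finset.sum_congr rfl fun p _ ↦ ?_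
    simp only [Pi.smul_apply, smul_eq_mul, Bform, ModularForm.coe_mul, ModularForm.coe_mcast,
      ModularForm.coe_pow, Pi.mul_apply, Pi.pow_apply, hA, hD, hF, hG, hG₁, coe_ofLevelOne,
      E₄cube_apply, delta_apply]
    rfl
  -- the polynomial `P(U, V) = ∑_{i,t} (-1)^i r(i,t) U^t V^i`
  refine ⟨∑ i : Fin (μ + 1), Polynomial.monomial (i : ℕ)
      (∑ t : Fin (n + 1), Polynomial.monomial (t : ℕ) ((-1) ^ (i : ℕ) * r (i, t))), ?_, ?_⟩
  · -- non-zero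
    intro hP
    apply hr0
    funext ⟨i, t⟩
    have hi := congrArg (fun P : ℚ[X][Y] => P.coeff (i : ℕ)) hP
    simp only [Polynomial.finsetSum_coeff, Polynomial.coeff_monomial, Polynomial.coeff_zero] at hi
    rw [Finset.sum_eq_single i (fun b _ hb => if_neg fun h => hb (Fin.ext h))
      (fun h => absurd (Finset.mem_univ i) h), if_pos rfl] at hi
    have ht := congrArg (fun c : ℚ[X] => c.coeff (t : ℕ)) hi
    simp only [Polynomial.finsetSum_coeff, Polynomial.coeff_monomial, Polynomial.coeff_zero] at ht
    rw [Finset.sum_eq_single t (fun b _ hb => if_neg fun h => hb (Fin.ext h))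
      (fun h => absurd (Finset.mem_univ t) h), if_pos rfl] at ht
    have : r (i, t) = 0 := by
      rcases mul_eq_zero.mp ht with h | h
      · exact absurd h (pow_ne_zero _ (by norm_num))
      · exact h
    simpa using this
  · -- the relation
    intro τ h4 h6
    have hΔ := ModularForm.discriminant_ne_zero τ
    have hG0 : E₄ τ ^ 2 * E₆ τ ≠ 0 := mul_ne_zero (pow_ne_zero _ h4) h6
    set v : ℂ := f τ * ModularForm.discriminant τ / (E₄ τ ^ 2 * E₆ τ) with hv
    have hdj : djQuot ⇑f τ = -v := by rw [djQuot, hv, neg_div]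
    have hfΔ : f τ * ModularForm.discriminant τ = v * (E₄ τ ^ 2 * E₆ τ) := by
      rw [hv, div_mul_cancel₀ _ hG0]
    have key := hpt τ
    simp only [hfΔ, E₄_cube_eq_kleinJ_mul τ] at key
    have hterm : ∀ p : Fin (μ + 1) × Fin (n + 1), ((r p : ℚ) : ℂ) *
        ((kleinJ τ * ModularForm.discriminant τ) ^ (p.2 : ℕ) *
          ModularForm.discriminant τ ^ (n - p.2) *
            ((v * (E₄ τ ^ 2 * E₆ τ)) ^ (p.1 : ℕ) * (E₄ τ ^ 2 * E₆ τ) ^ (μ - p.1))) =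
        ((r p : ℚ) : ℂ) * (kleinJ τ ^ (p.2 : ℕ) * v ^ (p.1 : ℕ)) *
          (ModularForm.discriminant τ ^ n * (E₄ τ ^ 2 * E₆ τ) ^ μ) := by
      rintro ⟨i, t⟩
      have hi : (i : ℕ) ≤ μ := Nat.lt_succ_iff.mp i.isLt
      have ht : (t : ℕ) ≤ n := Nat.lt_succ_iff.mp t.isLt
      have hdn : ModularForm.discriminant τ ^ n =
          ModularForm.discriminant τ ^ (t : ℕ) * ModularForm.discriminant τ ^ (n - t) := by
        rw [← pow_add, Nat.add_sub_cancel' ht]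
      have hgμ : (E₄ τ ^ 2 * E₆ τ) ^ μ =
          (E₄ τ ^ 2 * E₆ τ) ^ (i : ℕ) * (E₄ τ ^ 2 * E₆ τ) ^ (μ - i) := by
        rw [← pow_add, Nat.add_sub_cancel' hi]
      simp only
      rw [hdn, hgμ, mul_pow, mul_pow]
      ring
    simp only [hterm, ← Finset.sum_mul] at key
    have hsum : ∑ p : Fin (μ + 1) × Fin (n + 1),
        ((r p : ℚ) : ℂ) * (kleinJ τ ^ (p.2 : ℕ) * v ^ (p.1 : ℕ)) = 0 := by
      rcases mul_eq_zero.mp key with h | h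
      · exact h
      · exact absurd h (mul_ne_zero (pow_ne_zero _ hΔ) (pow_ne_zero _ hG0))
    rw [Fintype.sum_prod_type] at hsum
    rw [hdj, Polynomial.eval₂_finsetSum, ← hsum]
    refine Finset.sum_congr rfl fun i _ => ?_
    rw [Polynomial.eval₂_monomial]
    have hφ : ∀ c : ℚ[X], ((Polynomial.aeval (R := ℚ) (kleinJ τ) : ℚ[X] →+* ℂ) c : ℂ) =
        Polynomial.aeval (kleinJ τ) c := fun c => rfl
    rw [hφ, map_sum, Finset.sum_mul]
    refine Finset.sum_congr rfl fun t _ => ?_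
    rw [Polynomial.aeval_monomial, map_mul, map_pow, map_neg, map_one, neg_pow v]
    have h1' : ((-1 : ℂ) ^ (i : ℕ)) * (-1) ^ (i : ℕ) = 1 := by
      rw [← mul_pow, neg_one_mul, neg_neg, one_pow]
    rw [eq_ratCast]
    linear_combination (((r (i, t) : ℚ) : ℂ) * kleinJ τ ^ (t : ℕ) * v ^ (i : ℕ)) * h1'

/-- **Transport along `SL₂(ℤ)`**: `djQuot (φ ∣₂ g) τ = djQuot φ (g • τ)` for every `φ : ℍ → ℂ`
and `g ∈ SL₂(ℤ)`: `Δ`, `E₄`, `E₆` are level-one forms of weights `12`, `4`, `6`, so in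
`-φ(gτ)Δ(gτ)/(E₄(gτ)²E₆(gτ))` the automorphy factors `(cτ+d)^{2+12}` of the numerator and
`(cτ+d)^{2·4+6}` of the denominator cancel (both sides are the junk value `0` where `E₄E₆ = 0`).
[folklore] -/
theorem djQuot_SL_slash (φ : ℍ → ℂ) (g : SL(2, ℤ)) (τ : ℍ) :
    djQuot (φ ∣[(2 : ℤ)] g) τ = djQuot φ (g • τ) := by
  have hd := denom_ne_zero g τ
  rw [djQuot, djQuot, ModularForm.SL_slash_apply, levelOne_apply_smul ModularForm.E₄ g τ,
    levelOne_apply_smul ModularForm.E₆ g τ, discriminant_apply_smul g τ]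
  have h12 : denom (g : GL (Fin 2) ℝ) τ ^ (12 : ℤ) = denom (g : GL (Fin 2) ℝ) τ ^ (12 : ℕ) := by
    norm_cast
  have h4 : denom (g : GL (Fin 2) ℝ) τ ^ (4 : ℤ) = denom (g : GL (Fin 2) ℝ) τ ^ (4 : ℕ) := by
    norm_cast
  have h6 : denom (g : GL (Fin 2) ℝ) τ ^ (6 : ℤ) = denom (g : GL (Fin 2) ℝ) τ ^ (6 : ℕ) := by
    norm_cast
  have h2 : denom (g : GL (Fin 2) ℝ) τ ^ (-2 : ℤ) = (denom (g : GL (Fin 2) ℝ) τ ^ (2 : ℕ))⁻¹ := by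
    rw [zpow_neg]; norm_cast
  rw [h12, h4, h6, h2]
  by_cases h0 : E₄ τ ^ 2 * E₆ τ = 0
  · have : (denom (g : GL (Fin 2) ℝ) τ ^ (4 : ℕ) * E₄ τ) ^ 2 *
        (denom (g : GL (Fin 2) ℝ) τ ^ (6 : ℕ) * E₆ τ) = 0 := by
      rw [show (denom (g : GL (Fin 2) ℝ) τ ^ (4 : ℕ) * E₄ τ) ^ 2 *
          (denom (g : GL (Fin 2) ℝ) τ ^ (6 : ℕ) * E₆ τ) =
          (denom (g : GL (Fin 2) ℝ) τ ^ (4 : ℕ)) ^ 2 * denom (g : GL (Fin 2) ℝ) τ ^ (6 : ℕ) *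
            (E₄ τ ^ 2 * E₆ τ) by ring, h0, mul_zero]
    rw [h0, this, div_zero, div_zero]
  · have h0' : (denom (g : GL (Fin 2) ℝ) τ ^ (4 : ℕ) * E₄ τ) ^ 2 *
        (denom (g : GL (Fin 2) ℝ) τ ^ (6 : ℕ) * E₆ τ) ≠ 0 := by
      rw [show (denom (g : GL (Fin 2) ℝ) τ ^ (4 : ℕ) * E₄ τ) ^ 2 *
          (denom (g : GL (Fin 2) ℝ) τ ^ (6 : ℕ) * E₆ τ) =
          (denom (g : GL (Fin 2) ℝ) τ ^ (4 : ℕ)) ^ 2 * denom (g : GL (Fin 2) ℝ) τ ^ (6 : ℕ) *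
            (E₄ τ ^ 2 * E₆ τ) by ring]
      exact mul_ne_zero (mul_ne_zero (pow_ne_zero _ (pow_ne_zero _ hd)) (pow_ne_zero _ hd)) h0
    rw [div_eq_div_iff h0 h0']
    field_simp

end Relation

/-! ### Assembly: the discharge -/

section Assembly

open ModularForm

variable {N : ℕ} [NeZero N]

/-- **The canonical integrand satisfies the primitive rational relation on the whole half-line.**
For `f ∈ S₂(Γ₀(N))` with rational coefficients and `g ∈ SL₂(ℤ)` there is a PRIMITIVE
`P₁ ∈ ℚ[U][V]` (so `P₁(u, ·) ≠ 0` for every `u`, `map_ne_zero_of_isPrimitive`) with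
`P₁(u, arcIntegrand (f ∣ g) u) = 0` for all `u > 1728`: the relation of
`exists_rat_relation_djQuot` transported by `djQuot_SL_slash` and `j(g·τ) = j(τ) = u` at
`τ = i t₊(u)`, divided by the content off its finitely many real zeros and extended to them by
continuity of the integrand (`continuousOn_arcIntegrand`).
[cite: Shimura1971, §6.2 Thm. 6.6 (1)–(2) and Prop. 6.9 (1)] -/
theorem exists_isPrimitive_evalC_arcIntegrand_eq_zero (f : CuspForm (Gamma0 N) 2)
    (hf : HasRatCoeffs f) (g : SL(2, ℤ)) :
    ∃ P₁ : ℚ[X][Y], P₁.IsPrimitive ∧ ∀ u : ℝ, 1728 < u →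
      eval₂ (Polynomial.aeval (R := ℚ) (u : ℂ) : ℚ[X] →+* ℂ) (arcIntegrand (⇑f ∣[(2 : ℤ)] g) u) P₁
        = 0 := by
  classical
  obtain ⟨P, hP0, hP⟩ := exists_rat_relation_djQuot f hf
  refine ⟨P.primPart, P.isPrimitive_primPart, ?_⟩
  have hc0 : P.content ≠ 0 := by rwa [Ne, Polynomial.content_eq_zero_iff]
  set w : ℝ → ℂ := arcIntegrand (⇑f ∣[(2 : ℤ)] g) with hw
  -- the relation for `P` on the half-line
  have hPw : ∀ u : ℝ, 1728 < u →
      eval₂ (Polynomial.aeval (R := ℚ) (u : ℂ) : ℚ[X] →+* ℂ) (w u) P = 0 := by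
    intro u hu
    have ht := one_lt_axisParam hu
    have hj : kleinJ (g • axisPt (axisParam u)) = u := by
      rw [kleinJ_smul, kleinJ_axisPt_axisParam hu]
    have h4 : E₄ (g • axisPt (axisParam u)) ≠ 0 := by
      rw [levelOne_apply_smul]
      exact mul_ne_zero (zpow_ne_zero _ (denom_ne_zero _ _)) (E₄_axisPt_ne_zero ht)
    have h6 : E₆ (g • axisPt (axisParam u)) ≠ 0 := by
      rw [levelOne_apply_smul]
      exact mul_ne_zero (zpow_ne_zero _ (denom_ne_zero _ _)) (E₆_axisPt_ne_zero ht)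
    have := hP (g • axisPt (axisParam u)) h4 h6
    rwa [hj, ← djQuot_SL_slash] at this
  -- `P = c · P₁`
  have hfact : ∀ (u : ℝ) (z : ℂ), eval₂ (Polynomial.aeval (R := ℚ) (u : ℂ) : ℚ[X] →+* ℂ) z P =
      Polynomial.aeval (u : ℂ) P.content *
        eval₂ (Polynomial.aeval (R := ℚ) (u : ℂ) : ℚ[X] →+* ℂ) z P.primPart := by
    intro u z
    conv_lhs => rw [P.eq_C_content_mul_primPart]
    rw [Polynomial.eval₂_mul, Polynomial.eval₂_C]
    rfl
  -- the real zeros of the content are finite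
  have hZfin : {u : ℝ | Polynomial.aeval (u : ℂ) P.content = 0}.Finite := by
    have hne : P.content.map (algebraMap ℚ ℝ) ≠ 0 := by
      rwa [Ne, Polynomial.map_eq_zero_iff (algebraMap ℚ ℝ).injective]
    refine (Polynomial.finite_setOf_isRoot hne).subset fun u hu => ?_
    rw [mem_setOf_eq] at hu
    rw [mem_setOf_eq, Polynomial.IsRoot.def, Polynomial.eval_map, ← Polynomial.aeval_def]
    have h' : ((Polynomial.aeval u P.content : ℝ) : ℂ) = 0 := by
      rw [← hu]
      exact (Polynomial.aeval_algebraMap_apply ℂ u P.content).symm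
    exact_mod_cast h'
  -- continuity of `u ↦ P₁(u, w u)` on the half-line
  have hcontw : ContinuousOn w (Ioi 1728) :=
    continuousOn_arcIntegrand (isCuspFunction_slash f g).mdifferentiable
  have hcontE : ContinuousOn
      (fun u : ℝ => eval₂ (Polynomial.aeval (R := ℚ) (u : ℂ) : ℚ[X] →+* ℂ) (w u) P.primPart)
      (Ioi 1728) := by
    have heq : (fun u : ℝ => eval₂ (Polynomial.aeval (R := ℚ) (u : ℂ) : ℚ[X] →+* ℂ) (w u) P.primPart)
        = fun u : ℝ =>
          ∑ i ∈ P.primPart.support, Polynomial.aeval (u : ℂ) (P.primPart.coeff i) * w u ^ i := by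
      funext u
      rw [Polynomial.eval₂_eq_sum, Polynomial.sum_def]
      rfl
    rw [heq]
    refine continuousOn_finsetSum _ fun i _ => ContinuousOn.mul ?_ (hcontw.pow i)
    have hc : Continuous fun u : ℝ => Polynomial.aeval (u : ℂ) (P.primPart.coeff i) := by
      have : (fun u : ℝ => Polynomial.aeval (u : ℂ) (P.primPart.coeff i)) =
          fun u : ℝ => ((P.primPart.coeff i).map (algebraMap ℚ ℂ)).eval (u : ℂ) := by
        funext u
        rw [Polynomial.eval_map, Polynomial.aeval_def]
      rw [this]
      exact (Polynomial.continuous _).comp Complex.continuous_ofReal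
    exact hc.continuousOn
  -- `P₁(u, w u) = 0` off the zeros of the content, hence everywhere by density
  have hEq : EqOn
      (fun u : ℝ => eval₂ (Polynomial.aeval (R := ℚ) (u : ℂ) : ℚ[X] →+* ℂ) (w u) P.primPart)
      (fun _ => 0) (Ioi 1728 \ {u | Polynomial.aeval (u : ℂ) P.content = 0}) := by
    rintro u ⟨hu, hcu⟩
    have h := hPw u hu
    rw [hfact] at h
    exact (mul_eq_zero.mp h).resolve_left hcu
  have hcl :
      Ioi (1728 : ℝ) ⊆ closure (Ioi 1728 \ {u | Polynomial.aeval (u : ℂ) P.content = 0}) := by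
    have hd : Dense (univ \ {u : ℝ | Polynomial.aeval (u : ℂ) P.content = 0}) :=
      dense_univ.sdiff_finite hZfin
    rw [← compl_eq_univ_sdiff] at hd
    intro u hu
    rw [sdiff_eq]
    exact isOpen_Ioi.inter_closure ⟨hu, by rw [hd.closure_eq]; exact mem_univ _⟩
  have hall := hEq.of_subset_closure hcontE continuousOn_const sdiff_subset hcl
  intro u hu
  exact hall hu

/-- The vertical fibre of a subset of `ℝ²` over a point of `ℝ¹`, unfolded. [folklore] -/
theorem setOf_snoc_mem_eq (x : Fin 1 → ℝ) (p : ℝ → ℝ → Prop) :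
    {t : ℝ | (Fin.snoc x t : Fin 2 → ℝ) ∈ {y : Fin 2 → ℝ | p (y 0) (y 1)}} = {t | p (x 0) t} := by
  ext t
  simp only [mem_setOf_eq]
  have h0 : (Fin.snoc x t : Fin 2 → ℝ) 0 = x 0 := by
    rw [show (0 : Fin 2) = Fin.castSucc (0 : Fin 1) from rfl, Fin.snoc_castSucc]
  have h1 : (Fin.snoc x t : Fin 2 → ℝ) 1 = t := by
    rw [show (1 : Fin 2) = Fin.last 1 from rfl, Fin.snoc_last]
  rw [h0, h1]

/-- **Discharge of the named fact `isSemialgebraicFunOn_arcIntegrand_slash`**: for a weight-`2`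
cusp form `f` on `Γ₀(N)` with rational Fourier coefficients and `g ∈ SL₂(ℤ)`, the real and
imaginary parts of the canonical integrand `u ↦ (ω_f/dj)(g · i t₊(u))` are `ℚ`-semialgebraic on
`(1728, ∞)`. Algebraicity over `ℚ(j)` (Shimura Thm. 6.6, Prop. 6.9; here by the Sturm count over
`ℚ`, `exists_isPrimitive_evalC_arcIntegrand_eq_zero`), continuity (`continuousOn_arcIntegrand`),
and cylindrical decomposition over `ℚ` (Basu–Pollack–Roy Thm. 5.6 / Cor. 5.7, the selection lemma
`isSemialgebraicFunOn_of_continuousOn_of_finite_fibres`) applied to the Tarski–Seidenberg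
projections of `{(u, a, b) | P₁(u, a + ib) = 0}`.
[cite: Shimura1971, §6.2 Thm. 6.6 (1)–(2) and Prop. 6.9 (1); BasuPollackRoy2006, Thm. 5.6,
Def. 5.1, Prop. 5.3, Thm. 2.76–2.77; KontsevichZagier2001, §3.4] -/
theorem isSemialgebraicFunOn_arcIntegrand_slash_holds :
    isSemialgebraicFunOn_arcIntegrand_slash := by
  intro N _ f hf g
  obtain ⟨P₁, hprim, hP₁⟩ := exists_isPrimitive_evalC_arcIntegrand_eq_zero f hf g
  have hD := isSemialgebraic_arcDomain
  have hcontw : ContinuousOn (arcIntegrand (⇑f ∣[(2 : ℤ)] g)) (Ioi 1728) :=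
    continuousOn_arcIntegrand (isCuspFunction_slash f g).mdifferentiable
  have hcontD :
      ContinuousOn (fun x : Fin 1 → ℝ => arcIntegrand (⇑f ∣[(2 : ℤ)] g) (x 0)) arcDomain :=
    hcontw.comp (continuous_apply 0).continuousOn fun x hx => hx
  constructor
  · refine isSemialgebraicFunOn_of_continuousOn_of_finite_fibres
      (isSemialgebraic_setOf_exists_evalC_re P₁) (fun x => ?_) hD
      (Complex.continuous_re.comp_continuousOn hcontD) fun x hx => ?_
    · rw [setOf_snoc_mem_eq x fun u a => ∃ b : ℝ,
        eval₂ (Polynomial.aeval (R := ℚ) (u : ℂ) : ℚ[X] →+* ℂ) ((a : ℂ) + (b : ℂ) * Complex.I) P₁ = 0]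
      exact (finite_re_of_map_ne_zero P₁ (map_ne_zero_of_isPrimitive hprim (x 0))).1
    · show (Fin.snoc x (arcIntegrand (⇑f ∣[(2 : ℤ)] g) (x 0)).re : Fin 2 → ℝ) ∈
        {y : Fin 2 → ℝ | ∃ b : ℝ, eval₂ (Polynomial.aeval (R := ℚ) (y 0 : ℂ) : ℚ[X] →+* ℂ)
          ((y 1 : ℂ) + (b : ℂ) * Complex.I) P₁ = 0}
      have h := (Set.ext_iff.mp (setOf_snoc_mem_eq x fun u a => ∃ b : ℝ,
        eval₂ (Polynomial.aeval (R := ℚ) (u : ℂ) : ℚ[X] →+* ℂ) ((a : ℂ) + (b : ℂ) * Complex.I) P₁ = 0)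
        (arcIntegrand (⇑f ∣[(2 : ℤ)] g) (x 0)).re).mpr
      apply h
      refine ⟨(arcIntegrand (⇑f ∣[(2 : ℤ)] g) (x 0)).im, ?_⟩
      rw [Complex.re_add_im]
      exact hP₁ (x 0) hx
  · refine isSemialgebraicFunOn_of_continuousOn_of_finite_fibres
      (isSemialgebraic_setOf_exists_evalC_im P₁) (fun x => ?_) hD
      (Complex.continuous_im.comp_continuousOn hcontD) fun x hx => ?_
    · rw [setOf_snoc_mem_eq x fun u b => ∃ a : ℝ,
        eval₂ (Polynomial.aeval (R := ℚ) (u : ℂ) : ℚ[X] →+* ℂ) ((a : ℂ) + (b : ℂ) * Complex.I) P₁ = 0]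
      exact (finite_re_of_map_ne_zero P₁ (map_ne_zero_of_isPrimitive hprim (x 0))).2
    · show (Fin.snoc x (arcIntegrand (⇑f ∣[(2 : ℤ)] g) (x 0)).im : Fin 2 → ℝ) ∈
        {y : Fin 2 → ℝ | ∃ a : ℝ, eval₂ (Polynomial.aeval (R := ℚ) (y 0 : ℂ) : ℚ[X] →+* ℂ)
          ((a : ℂ) + (y 1 : ℂ) * Complex.I) P₁ = 0}
      have h := (Set.ext_iff.mp (setOf_snoc_mem_eq x fun u b => ∃ a : ℝ,
        eval₂ (Polynomial.aeval (R := ℚ) (u : ℂ) : ℚ[X] →+* ℂ) ((a : ℂ) + (b : ℂ) * Complex.I) P₁ = 0)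
        (arcIntegrand (⇑f ∣[(2 : ℤ)] g) (x 0)).im).mpr
      apply h
      refine ⟨(arcIntegrand (⇑f ∣[(2 : ℤ)] g) (x 0)).re, ?_⟩
      rw [Complex.re_add_im]
      exact hP₁ (x 0) hx

end Assembly

end Literature.NumberTheory.EllipticCurves.ModularForms

end
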